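import Literature.NumberTheory.EllipticCurves.InertiaReductionAutomorphismProofs
import Literature.NumberTheory.EllipticCurves.ReductionInertiaInvarianceProofs
import Literature.NumberTheory.GaloisRepresentations.AbsGaloisGroup
import HarnessLib

/-!
# T-ROL-G F-A1: the kernel of reduction of a GOOD MODEL over the valuation ring of a valued field
# is stable under every isometry (Serre–Tate descent datum in Weierstrass coordinates); a uniform
# power of every Galois element fixes finitely many algebraic elements (team n1011, row T-ROL-G;
# seat p05 GEN 5; lead R5-57; referee-1 ACK-1 GEN 16)

HONEST FRAMING (cell `b2b-bsdres`, run/shared/lean/b2b/bsd-rank1-residual/, verbatim in every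
file): the goal of the cell is to DELETE the COMBINATION-SHAPED residual classes of the
Birch–Swinnerton-Dyer formula for ALL analytic-rank `≤ 1` elliptic curves over `ℚ` — "full BSD
formula for every rank `≤ 1` curve in class `C`" assembled STRICTLY from published theorems — so
that the rank-`≤ 1` remainder becomes exactly the CONSTRUCTION-SHAPED classes, which are TYPED
(missing-input `Prop`s), NOT attempted. This is not "finishing BSD". Team n1011 (N10/N11): research
route on the CONSTRUCTION-SHAPED classes X3♯(G-ord)/X4♯(G-ord); prove what is provable now; no
claim beyond stated classes; census output = EVIDENCE, never a Literature fact; RESIDUAL-MAP marks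
UNCHANGED; nothing is booked by this file. TOOL theorems only: NO definition, NO named fact, NO
conjecture node.

## The row (T-ROL-G) in one paragraph

p10's TB-ROL FILE B (`Additive/GordRamifiedOrdinaryLine.lean`) constructs the ramified ordinary
line of an X4♯(G-ord)/X3♯(G-ord) row as Greenberg's `C_v(V)` of a `ℚ`-MODEL `V` of the `p*`-twist,
hence only for the defect `e_E(p) = 2` (Kodaira `I₀*`). On the rows with `e ∈ {3, 4, 6}` (`p ≥ 5`,
`p ≡ 1 (mod e)`; N10 `CellGordHigher`) no curve over `ℚ` plays `V` (class file of record: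
"Gord_e346 — line existence / R-D untyped", class-closure/N10/WEEK-2026-08-28-INPUT-typer2 §5). The
row builds the line WITHOUT a twist model and WITHOUT any number-field extension, from a **good
model** `W₀ = C • E ⊗ K̄_v` — a Weierstrass equation with unit discriminant over the valuation ring
`𝒪_w` of the spectral valuation `w = |·|_v` of `K̄_v = \overline{ℚ_v}`, `C` a change of variables
over `K̄_v` (it exists iff `ord_p j(E) ≥ 0`: Deuring's form, the tree's
`exists_variableChange_eq_baseChange_isUnit_Δ_of_val_j_le_one`) — as
`C = E[p^∞] ∩ ker(red_{W₀} ∘ Φ_C ∘ ι)` (`Φ_C` the substitution, `ι : E(ℚ̄) → E(K̄_v)` the chosen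
embedding), and proves the five conjuncts of cc-typer-1's
`EmertonPollackWeston2006.IsRamifiedOrdinaryLine W p` (EPW §3.1's `A'_{f̃,a}`; Coates' canonical
subgroup, LNM 1716 (62); Greenberg's `ℱ[p^∞]` over the good field, LNM 1716 §2 pp. 62–63) from tree
theorems only. Three files: F-A1 `GoodModelReductionKernel` (valued-field level), F-A2
`GoodModelReductionDatum` (the datum; divisible / proper / non-zero / infinitely many reductions
under the ordinary hypothesis), F-A3 `GoodModelReductionLine` (inertia finite + non-trivial;
assembly).

## This file (generic: any valued field `(L, w)`, `X/F`, `F ⊆ L`)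

* §1 `goodReductionHom_pointEquiv_map_eq_zero_iff` — for a `w`-integral unit-discriminant model
  `W' = C • X_L = W₀ ⊗ L` and an ISOMETRY `σ ∈ Aut(L/F)` (NOT necessarily inertial),
  `red(Φ(P^σ)) = Õ ↔ red(Φ(P)) = Õ`: `A_σ = C(σC)⁻¹` carries the integral unit-discriminant model
  `σ(W')` to `W'`, so it is `w`-integral with `w(u) = 1` (Silverman *AEC* VII.1.3(d) in valuation
  form = the tree's `val_le_one_of_smul_eq_of_val_Δ_eq_one`), whence
  `x(Φ(P^σ)) = u⁻²(σ x(ΦP) − r)` is non-integral iff `x(ΦP)` is. This is the Serre–Tate descent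
  datum (Ann. of Math. 88 (1968) §2) in Weierstrass coordinates, complementing the tree's INERTIAL
  `exists_reducedAut_red_map_eq` (which describes the full reduction through `Ã_σ ∈ Aut(W̃₀)`) by
  the Frobenius-type elements, for the KERNEL.
  `goodReductionHom_pointEquiv_map_eq_of_map_eq` — an inertial isometry FIXING `C` does not change
  reductions (`reducePoint_some_eq_of_val`); `congrEquiv_pointEquiv_one`.
* §2 `exists_pos_forall_pow_smul_eq` — for a finite `S ⊂ K̄` some `n ≥ 1` has `σⁿ|_S = id` for
  EVERY `σ ∈ Γ_K` (the fixing subgroup of `K(S)` is open, Mathlib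
  `krullTopology_mem_nhds_one_iff_of_normal`, and `Aut_K(E₀)` of a finite normal `E₀` is finite).

References: J.-P. Serre, J. Tate, Ann. of Math. 88 (1968) §2 Thm. 2, Cor. 2 [SerreTate1968];
J. H. Silverman, *AEC* 2nd ed. VII.1.3(d), VII.2.1, VII.3.1(b), VII.5.5, VII.7.1, III.6.4(b)
[SilvermanAEC2009]; R. Greenberg, LNM 1716 (1999) §1 p. 62, §2 pp. 62–63 [GreenbergLNM1716];
J. Coates, LNM 1716 (1999) p. 31 (62) [CoatesLNM1716]; M. Emerton, R. Pollack, T. Weston, Invent.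
Math. 163 (2006) §3.1 (arXiv:math/0404484 p. 17) [EmertonPollackWeston2006]; J. Neukirch, *ANT*
IV §1 (Krull topology); cells/n1011/skel/T-ROL-G.md (fa05b6d488a62a53), referee-1 GEN 16 ACK-1,
lead R5-57; class-closure/N10/WEEK-2026-08-28-INPUT-typer2.md §2/§3/§5.
-/

noncomputable section

open scoped Classical NNReal

open WeierstrassCurve

universe u

namespace Summit.BirchSwinnertonDyer.Rank1Residual.Additive.GoodModelLine

open Literature.NumberTheory.EllipticCurves

/-! ## §1 The kernel of reduction of a good model is stable under every isometry -/

section Valued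

variable {L : Type u} [Field L] {w : Valuation L ℝ≥0} {F : Type*} [Field F] [Algebra F L]

/-- **`Γ`-stability of the kernel of reduction of a good model** (Serre–Tate descent datum in
Weierstrass coordinates). Let `W' = C • X_L = W₀ ⊗ L` be a `w`-integral model with unit discriminant
of the base change to `L` of a Weierstrass equation `X` over the subfield `F`, `C` defined over `L`,
and let `σ ∈ Aut(L/F)` be an isometry (NOT necessarily inertial). Then `Φ(P^σ)` reduces to `Õ` iff
`Φ(P)` does, `Φ : X(L) ≃ W₀(L)` the substitution: for `A_σ = C(σC)⁻¹` carries the integral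
unit-discriminant model `σ(W')` to `W'`, so it is `w`-integral with `w(u) = 1` (Silverman *AEC*
VII.1.3(d) in valuation form, the tree's `val_le_one_of_smul_eq_of_val_Δ_eq_one`), and
`x(Φ(P^σ)) = u⁻²(σ x(ΦP) − r)` is `w`-integral iff `x(ΦP)` is.
[cite: SerreTate1968, §2 Thm. 2 (mechanism of proof)]
[cite: SilvermanAEC2009, VII.1 Prop. 1.3(d) and VII.2 Prop. 2.1] -/
theorem goodReductionHom_pointEquiv_map_eq_zero_iff (X : WeierstrassCurve F) (C : VariableChange L)
    {W₀ : WeierstrassCurve w.integer} (hW₀ : C • X.baseChange L = W₀.baseChange L)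
    (hΔ : IsUnit W₀.Δ) (σ : L ≃ₐ[F] L) (hσ : ∀ z, w (σ z) = w z)
    (P : (X.baseChange L).toAffine.Point) :
    goodReductionHom W₀ (Valuation.integer.integers w) hΔ
        (Affine.Point.congrEquiv hW₀ (VariableChange.pointEquiv (X.baseChange L) C
          (Affine.Point.map (σ : L →ₐ[F] L) P))) = 0 ↔
      goodReductionHom W₀ (Valuation.integer.integers w) hΔ
        (Affine.Point.congrEquiv hW₀ (VariableChange.pointEquiv (X.baseChange L) C P)) = 0 := by
  have hv0 : w.Integers w.integer := Valuation.integer.integers w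
  have hinj : Function.Injective (algebraMap w.integer L) := hv0.hom_inj
  let O := w.integer
  set σr : L →+* L := (σ : L →+* L) with hσr
  -- `σ` restricted to `𝒪_w`
  have hσO : ∀ x ∈ w.integer, σr x ∈ w.integer := fun x hx ↦ by
    rw [Valuation.mem_integer_iff] at hx ⊢
    rw [hσr]; change w (σ x) ≤ 1; rw [hσ]; exact hx
  set σ₀ : O →+* O := σr.restrict w.integer w.integer hσO with hσ₀
  -- the change of variables `A = C (σC)⁻¹`
  set A : VariableChange L := C * (C.map σr)⁻¹ with hA
  have hXσ : (X.baseChange L).map σr = X.baseChange L := X.map_baseChange (σ : L →ₐ[F] L)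
  have hVσ : (W₀.baseChange L).map σr = (W₀.map σ₀).baseChange L := by
    rw [WeierstrassCurve.baseChange, WeierstrassCurve.baseChange, WeierstrassCurve.map_map,
      WeierstrassCurve.map_map]
    congr 1
  have hAW : A • (W₀.map σ₀).baseChange L = W₀.baseChange L := by
    rw [← hVσ, ← hW₀, ← map_variableChange, hXσ, hA, mul_smul, inv_smul_smul]
  haveI : ((W₀.map σ₀).baseChange L).IsIntegral O := ⟨W₀.map σ₀, rfl⟩
  haveI : (A • (W₀.map σ₀).baseChange L).IsIntegral O := by rw [hAW]; exact ⟨W₀, rfl⟩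
  have hΔL : w (W₀.baseChange L).Δ = 1 := by
    rw [WeierstrassCurve.baseChange, map_Δ]
    exact (hv0.isUnit_iff_valuation_eq_one).mp hΔ
  have hΔσ : w ((W₀.map σ₀).baseChange L).Δ = 1 := by
    rw [← hVσ, map_Δ, hσr]
    change w (σ (W₀.baseChange L).Δ) = 1
    rw [hσ, hΔL]
  obtain ⟨hu, hr, -, -⟩ := val_le_one_of_smul_eq_of_val_Δ_eq_one ((W₀.map σ₀).baseChange L) A
    hΔσ (by rw [hAW]; exact hΔL)
  -- the coordinate identity `C.toX (σ x) = A.toX (σ (C.toX x))`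
  have hAC : A * C.map σr = C := by rw [hA, inv_mul_cancel_right]
  have keyX : ∀ x : L, C.toX (σ x) = A.toX (σ (C.toX x)) := fun x ↦ by
    change C.toX (σr x) = A.toX (σr (C.toX x))
    rw [map_toX_ringHom, ← toX_mul, hAC]
  rcases P with _ | ⟨x, y, h⟩
  · simp only [← Affine.Point.zero_def, map_zero]
  have hσns : (X.baseChange L).toAffine.Nonsingular (σ x) (σ y) := by
    have h1 : ((X.baseChange L).map σr).toAffine.Nonsingular (σ x) (σ y) :=
      (Affine.map_nonsingular _ σr.injective x y).mpr h
    rwa [hXσ] at h1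
  have hmapP : Affine.Point.map (σ : L →ₐ[F] L) (.some x y h) = .some (σ x) (σ y) hσns := by
    rw [Affine.Point.map_some]
    exact point_some_congr rfl rfl
  rw [hmapP, VariableChange.pointEquiv_some, VariableChange.pointEquiv_some,
    Affine.Point.congrEquiv_some, Affine.Point.congrEquiv_some, goodReductionHom_eq_zero_iff,
    goodReductionHom_eq_zero_iff, reducesToZero_some_iff, reducesToZero_some_iff,
    not_mem_range_iff hv0, not_mem_range_iff hv0, keyX, VariableChange.toX_def, map_mul, map_pow,
    Units.val_inv_eq_inv_val, map_inv₀, hu, inv_one, one_pow, one_mul]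
  set x' := C.toX x with hx'
  constructor
  · intro hlt
    by_contra hle
    rw [not_lt] at hle
    have h1 : w (σ x' - A.r) ≤ 1 := by
      refine (Valuation.map_sub w _ _).trans (max_le ?_ hr)
      rw [hσ]; exact hle
    exact absurd hlt (not_lt.mpr h1)
  · intro hlt
    have hlt' : w A.r < w (σ x') := by rw [hσ]; exact lt_of_le_of_lt hr hlt
    rw [Valuation.map_sub_eq_of_lt_left w hlt', hσ]
    exact hlt

/-- **An inertial isometry fixing the good model does not change reductions.** In the setting of
`goodReductionHom_pointEquiv_map_eq_zero_iff`, if moreover `σ` acts trivially on the residue field of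
`𝒪_w` (an inertia element) and FIXES the change of variables `C` (so `σ(W') = W'` and
`A_σ = 1`), then `red(Φ(P^σ)) = red(Φ(P))` for every `P ∈ X(L)`: the coordinates of `Φ(P^σ)` are
the `σ`-conjugates of those of `Φ(P)`, congruent to them modulo `𝔪_w` (the tree's
`reducePoint_some_eq_of_val`). Silverman *AEC* VII.§2 ("inertia acts trivially on `Ẽ`" for a model
with good reduction defined over the fixed field of `σ`). [cite: SilvermanAEC2009, Prop. VII.2.1]
[cite: SerreTate1968, §2 Thm. 2 (mechanism of proof)] -/
theorem goodReductionHom_pointEquiv_map_eq_of_map_eq (X : WeierstrassCurve F) (C : VariableChange L)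
    {W₀ : WeierstrassCurve w.integer} (hW₀ : C • X.baseChange L = W₀.baseChange L)
    (hΔ : IsUnit W₀.Δ) (σ : L ≃ₐ[F] L) (hσ : ∀ z, w (σ z) = w z)
    (hσI : ∀ z, w z ≤ 1 → w (σ z - z) < 1) (hC : C.map (σ : L →+* L) = C)
    (P : (X.baseChange L).toAffine.Point) :
    goodReductionHom W₀ (Valuation.integer.integers w) hΔ
        (Affine.Point.congrEquiv hW₀ (VariableChange.pointEquiv (X.baseChange L) C
          (Affine.Point.map (σ : L →ₐ[F] L) P))) =
      goodReductionHom W₀ (Valuation.integer.integers w) hΔ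
        (Affine.Point.congrEquiv hW₀ (VariableChange.pointEquiv (X.baseChange L) C P)) := by
  set σr : L →+* L := (σ : L →+* L) with hσr
  have hXσ : (X.baseChange L).map σr = X.baseChange L := X.map_baseChange (σ : L →ₐ[F] L)
  have keyX : ∀ x : L, C.toX (σ x) = σ (C.toX x) := fun x ↦ by
    change C.toX (σr x) = σr (C.toX x)
    rw [map_toX_ringHom, hC]
  have keyY : ∀ x y : L, C.toY (σ x) (σ y) = σ (C.toY x y) := fun x y ↦ by
    change C.toY (σr x) (σr y) = σr (C.toY x y)
    rw [map_toY_ringHom, hC]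
  rcases P with _ | ⟨x, y, h⟩
  · simp only [← Affine.Point.zero_def, map_zero]
  have hσns : (X.baseChange L).toAffine.Nonsingular (σ x) (σ y) := by
    have h1 : ((X.baseChange L).map σr).toAffine.Nonsingular (σ x) (σ y) :=
      (Affine.map_nonsingular _ σr.injective x y).mpr h
    rwa [hXσ] at h1
  have hmapP : Affine.Point.map (σ : L →ₐ[F] L) (.some x y h) = .some (σ x) (σ y) hσns := by
    rw [Affine.Point.map_some]
    exact point_some_congr rfl rfl
  rw [hmapP, VariableChange.pointEquiv_some, VariableChange.pointEquiv_some,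
    Affine.Point.congrEquiv_some, Affine.Point.congrEquiv_some]
  simp only [goodReductionHom_apply]
  set x' := C.toX x with hx'
  set y' := C.toY x y with hy'
  have hnsΦ : (W₀.baseChange L).toAffine.Nonsingular x' y' :=
    hW₀ ▸ (VariableChange.nonsingular_iff (X.baseChange L) C x y).mpr h
  have hnsσ : (W₀.baseChange L).toAffine.Nonsingular (σ x') (σ y') := by
    rw [← keyX, ← keyY]
    exact hW₀ ▸ (VariableChange.nonsingular_iff (X.baseChange L) C (σ x) (σ y)).mpr hσns
  have e₁ : WeierstrassCurve.reducePoint W₀ (.some (C.toX (σ x)) (C.toY (σ x) (σ y))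
      (hW₀ ▸ (VariableChange.nonsingular_iff (X.baseChange L) C (σ x) (σ y)).mpr hσns)) =
      WeierstrassCurve.reducePoint W₀ (.some (σ x') (σ y') hnsσ) :=
    congrArg _ (point_some_congr (keyX x) (keyY x y))
  have e₂ : WeierstrassCurve.reducePoint W₀ (.some x' y'
      (hW₀ ▸ (VariableChange.nonsingular_iff (X.baseChange L) C x y).mpr h)) =
      WeierstrassCurve.reducePoint W₀ (.some x' y' hnsΦ) := rfl
  rw [e₁, e₂]
  exact reducePoint_some_eq_of_val (W₀ := W₀) (hσ x') (hσI x') (hσI y')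

/-- The identity change of variables acts trivially on points (transport along `1 • V = V`).
[folklore] -/
theorem congrEquiv_pointEquiv_one {k : Type*} [Field k] (V : WeierstrassCurve k)
    {A : VariableChange k} (hA : A • V = V) (h1 : A = 1) (Q : V.toAffine.Point) :
    Affine.Point.congrEquiv hA (VariableChange.pointEquiv V A Q) = Q := by
  subst h1
  rcases Q with _ | ⟨x, y, h⟩
  · simp only [← Affine.Point.zero_def, map_zero]
  · rw [VariableChange.pointEquiv_some, Affine.Point.congrEquiv_some]
    exact point_some_congr (toX_one x) (toY_one x y)

end Valued

/-! ## §2 A power of every element of `Γ_K` fixes a given finite set of algebraic elements -/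

section Exponent

open Field Field.absoluteGaloisGroup

/-- **Uniform exponent**: for a finite set `S ⊂ K̄` there is `n ≥ 1` such that `σⁿ` fixes `S`
pointwise for EVERY `σ ∈ Γ_K = Gal(K̄/K)` (the fixing subgroup of `K(S)` is open, so it contains
`Gal(K̄/E₀)` for a finite normal `E₀/K` — Mathlib `krullTopology_mem_nhds_one_iff_of_normal` — and
`σ ↦ σ|_{E₀}` lands in the finite group `Aut_K(E₀)`, killed by its order). Neukirch, *ANT* IV §1.
[folklore] -/
theorem exists_pos_forall_pow_smul_eq {K : Type*} [Field K] {S : Set (AlgebraicClosure K)}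
    (hS : S.Finite) :
    ∃ n : ℕ, 0 < n ∧ ∀ σ : absoluteGaloisGroup K, ∀ c ∈ S, (σ ^ n) • c = c := by
  classical
  haveI : Finite S := hS.to_subtype
  set E : IntermediateField K (AlgebraicClosure K) := IntermediateField.adjoin K S with hE
  haveI : FiniteDimensional K E :=
    IntermediateField.finiteDimensional_adjoin (fun x _ ↦ Algebra.IsIntegral.isIntegral x)
  have h1 : (E.fixingSubgroup : Set (AlgebraicClosure K ≃ₐ[K] AlgebraicClosure K)) ∈
      nhds (1 : AlgebraicClosure K ≃ₐ[K] AlgebraicClosure K) :=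
    E.fixingSubgroup_isOpen.mem_nhds (one_mem E.fixingSubgroup)
  obtain ⟨E₀, hfd, hn, hsub⟩ :=
    (krullTopology_mem_nhds_one_iff_of_normal K (AlgebraicClosure K) _).mp h1
  haveI := hfd
  haveI := hn
  refine ⟨Fintype.card (E₀ ≃ₐ[K] E₀), Fintype.card_pos, fun σ c hc ↦ ?_⟩
  set n := Fintype.card (E₀ ≃ₐ[K] E₀) with hndef
  have hmem : toAlgEquiv K (σ ^ n) ∈ E.fixingSubgroup := by
    apply hsub
    rw [SetLike.mem_coe, IntermediateField.mem_fixingSubgroup_iff]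
    intro x hx
    have hpow : AlgEquiv.restrictNormalHom E₀ (toAlgEquiv K (σ ^ n)) = 1 := by
      rw [map_pow, map_pow, pow_card_eq_one]
    have h := AlgEquiv.restrictNormal_commutes (toAlgEquiv K (σ ^ n)) E₀ ⟨x, hx⟩
    change algebraMap E₀ (AlgebraicClosure K)
      (AlgEquiv.restrictNormalHom E₀ (toAlgEquiv K (σ ^ n)) ⟨x, hx⟩) = _ at h
    rw [hpow, AlgEquiv.one_apply] at h
    exact h.symm
  rw [IntermediateField.mem_fixingSubgroup_iff] at hmem
  rw [absoluteGaloisGroup.smul_def]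
  exact hmem c (IntermediateField.subset_adjoin K S hc)

end Exponent

end Summit.BirchSwinnertonDyer.Rank1Residual.Additive.GoodModelLine

end
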